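import Summits.QuantumFields.YangMills.Theorems.UnitScaleTiltProp7CurrentPairingPointwise
import Summits.QuantumFields.YangMills.Theorems.UnitScaleTiltProp7GreenOnPureGaugeSources
import Summits.QuantumFields.YangMills.Theorems.UnitScaleTiltProp7KernelColumnRowDuality
import Summits.QuantumFields.YangMills.Theorems.UnitScaleTiltProp7SectET3OpsT3HilbertRows
import HarnessLib

/-!
# Route `UnitScaleTilt`, crux K1 «MinimiserStabilityRegPr» (stmt-QuantumFields-19200), EX rows `norm_G`∕`norm_Hπ` — NORM_G ROAD brick N6, FILE C (★px19 g14 LOCATE-N6 fa94c431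
# §2(ii), §4 item 4): **THE `(sup, sup∘D*)` BOOTSTRAP `G_π = G₀ − G₀Δ′G_π`: VALUE AND DIVERGENCE ROWS OF `G_π = (Δ_πᴾ + DR_SD* + Q_k†aQ_k)⁻¹` FROM THOSE OF `G₀`, K-FREE,
# HÖLDER-FREE, NO SERIES** ([Balaban1985BackgroundPropagators] (3.130)–(3.131) «`G = G₀(I − Δ′_πG₀)⁻¹ … |⟨A₁, Δ′_πA₂⟩| ≤ O(1)Mα₀(‖D*A₁‖ + |A₁|)(|D*A₂| + |A₂|)`»)

Cell `ym3-torus` (HUMAN RULING D-0037; rung R3 = SU(2) YM₃ on T³ — NOT d = 4, NOT infinite volume, NOT a mass gap, NOT Clay).  Fleet lead ∕ chair seat `ym-ust-19200-p1` (gen 27),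
CHAIR WORD №28 «items 1–4 → ★p1».  THEOREMS ONLY (0 `def`, 0 `sorry`); `--supports stmt-QuantumFields-19200 --as helper`; count-neutral.

THE MATHEMATICS (LOCATE-N6 §2(ii), print p.421–422).  On the class at both slots, `u := G_πf` satisfies `u = G₀(Δ_a^{η}u) = G₀f − G₀(Δ′u)` with the perturbation
`Δ′u = Δ_πᴾu − Δ^ηu = −Δ^η(Dλ₁) − D(R_S(G′ᴾ j))`, `λ₁ := G′ᴾR_SD*u`, `j := D*Δ^η(Pᴾu)` (`Pᴾ = 1 − DG′ᴾR_SD*`, `Δ_πᴾ = Pᴾ†Δ^ηPᴾ`, `Pᴾ† = 1 − DR_SG′ᴾD*`); by FILE B's (G-iii)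
`G₀(D(R_S g)) = Dλ₂ − G₀(Δ^η(Dλ₂))`, `λ₂ := G′ᴾ(R_S g)`.  Hence `u = G₀f + G₀(Δ^η(Dλ₁)) + Dλ₂ − G₀(Δ^η(Dλ₂))`.  FILE A's (C-val) `|Δ^η(Dλ)| ≤ 4α|λ|_∞` and (C-div) `|D*Δ^ηy| ≤ 12α|y|_∞`,
the VALUE∕DIVERGENCE rows `BV`, `BD` of `G₀` (N4 ✓p768228, N5 ✓p768169) and the sup letters (c1) `|G′ᴾR_S·|`, (c2) `|DG′ᴾR_S·|`, (c3) `|R_SG′ᴾ·|` of the scalar storey give, for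
`X := sup|u| + sup|D*u|`, the FIXPOINT `X ≤ (BV + BD)·sup|f| + κ·X`, `κ = 4αC₁(BV+BD) + 12αC₃(1+C₂)(1 + C₂ + 4αC₁(BV+BD)) = O(α)` — so in the window `κ ≤ ½`, `X ≤ 2(BV+BD)·sup|f|`.
No Neumann series, no kernel rows, no Hölder norms: `G_π` EXISTS on the class (finite dimension), the bootstrap is the whole argument — print's «one of the three derivatives applied to the
right» is the divergence letter `sup|D*u|` (the word `DG′ᴾR_SD*` never meets a merely bounded field).

WHAT IS PROVED (ns `…Theorems.Prop7GreenPiSupRowsOfLetters`; member `F n K`, `h : n ≤ K`, weights `c₀ cB > 0`, coupling `0 ≤ a`).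
* §1 algebra: `adjoint_gaugeCorrP_apply` (`Pᴾ†y = y − DR_SG′ᴾD*y`), ★ `DeltaPiP_sub_DeltaEta_apply` (the two words of `Δ′u`),
  ★★★ `GT_pi_eq_four_terms` (`u = G₀f + G₀(Δ^η(Dλ₁)) + Dλ₂ − G₀(Δ^η(Dλ₂))` on the class at both slots), `covLapSite_lambda₂` (`D*Dλ₂ = R_S(G′ᴾj)`).
* §2 ★ `bootstrap_two` — the real-arithmetic fixpoint for the pair `(X_V, X_D)`.
* §3 ★★★★ **`valueDiv_rows_GTpi_of_letters`** — on `RegPr F n K α U₀`, `PosOnto` at `DeltaEtaSlot` and at `DeltaPiSlotP a`, the letters `hV hDiv hc1 hc2 hc3` and the window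
  `κ ≤ ½`: for every source `X` with `‖X b‖ ≤ s`, `‖(toL2⁻¹(G_π(toL2 X)))(b)‖ ≤ 2(BV+BD)·s` AND `‖(toL2S⁻¹(D*_{U₀}G_π(toL2 X)))(x)‖ ≤ 2(BV+BD)·s` — print's Thm 3.12
  (3.42)-VALUE row for `G` (3.122) at a T³ member, with its divergence companion, from the `G₀` rows.
EFFECT (numbers, not adjectives).  The (V) letter of N1∕N1-H for the Π-slot propagator `G_π` is reduced to five displayed member letters all of whose suppliers are named and
three of which are landed (N4, N5; (c1)–(c3) = ✓`hPcol_member_all`'s `hT1`∕`hGsup` readings, ≈ 60 l., px5∕px12 lineage); the same file at the slot `DeltaEtaSlot + T_J` (FILE B §3)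
gives `G₁` once the `T_J` rows dock (LOCATE-N6 §2(iii)).
HONEST SCOPE.  Algebra + a finite-dimensional bootstrap over displayed letters; no kernel estimate is proved here; nothing of `norm_G`, the 8 EX print rows, `hThm2S`, EX
`stub_existenceMinimalOrbit` or the crux is proved; nothing continuum ∕ OS ∕ mass-gap ∕ Clay.

References: T. Bałaban, CMP **99** (1985) 389–434 [Balaban1985BackgroundPropagators] ((3.117)–(3.122) pp.419–420, (3.130)–(3.131) pp.421–422, Thm 3.12 (3.42) pp.422–423, (3.26)–(3.27) p.395).
-/

set_option autoImplicit false

noncomputable section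

open scoped InnerProductSpace ComplexConjugate Matrix.Norms.L2Operator BigOperators

namespace Summit.QuantumFields.YangMills.Theorems.Prop7GreenPiSupRowsOfLetters

open Literature.MathematicalPhysics.QuantumFieldTheory.Balaban1983to89
open Literature.MathematicalPhysics.QuantumFieldTheory.Balaban1983to89.T3ContinuumYM3Torus
open T3PrintedRegularMinimiser (RegPr)
open T3SectALandauChart (eta eta_pos)
open B9Eq311L2Pairing (WL2)
open B11Eq103H1Complex (SiteL2K BondL2K)
open Summit.QuantumFields.YangMills.Theorems.Prop7SectET3Transport (periodsT3)
open Summit.QuantumFields.YangMills.Theorems.Prop7SectET3HilbertLetters (W₂ toL2 toL2S QL2 DL2 DstarL2 covLapSite adjoint_DL2)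
open Summit.QuantumFields.YangMills.Theorems.Prop7SectET3GaugeProjector (NS RS RS_RS)
open Summit.QuantumFields.YangMills.Theorems.Prop7SectET3WilsonHessian (DeltaEta DeltaEtaSlot DeltaEtaSlot_apply)
open Summit.QuantumFields.YangMills.Theorems.Prop7SectET3CurvedPropagators (Qk laplaceA PosOnto GT laplaceA_GT GT_laplaceA)
open Summit.QuantumFields.YangMills.Theorems.Prop7SectET3DeltaPiPInv (kerDProj GprimeP gaugeCorrP DeltaPiP DeltaPiSlotP gaugeCorrP_apply DeltaPiP_apply DeltaPiSlotP_apply)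
open Summit.QuantumFields.YangMills.Theorems.Prop7SectET3OpsT3HilbertRows (laplaceA_sub_laplaceA)
open Summit.QuantumFields.YangMills.Theorems.Prop7KernelColumnRowDuality (adjoint_GprimeP_RS_DstarL2)
open Summit.QuantumFields.YangMills.Theorems.Prop7GreenOnPureGaugeSources (GT_DeltaEtaSlot_DL2_RS_eq covLapSite_GprimeP_RS)
open Summit.QuantumFields.YangMills.Theorems.Prop7CurrentPairingPointwise (norm_symm_DeltaEta_DL2_toL2S_apply_le_of_sup norm_symm_DstarL2_DeltaEta_toL2_apply_le)

variable {F : T3Family} {n K : ℕ} {h : n ≤ K} {c₀ cB a : ℝ} [Fact (0 < c₀)] [Fact (0 < cB)]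

/-! ## §1 The algebra: `Pᴾ†`, the two words of `Δ′`, and `u = G₀f + G₀(Δ^η(Dλ₁)) + Dλ₂ − G₀(Δ^η(Dλ₂))` -/

/-- `Pᴾ†y = y − D(R_S(G′ᴾ(D*y)))` — the adjoint of the gauge correction `Pᴾ = 1 − DG′ᴾR_SD*` (✓`adjoint_GprimeP_RS_DstarL2`, ✓`adjoint_DL2`).
[cite: Balaban1985BackgroundPropagators, (3.119) p.419, (3.21)–(3.25) p.394] -/
theorem adjoint_gaugeCorrP_apply (ha : 0 ≤ a) (U₀ : GaugeField (F.P K) 0 (Matrix.specialUnitaryGroup (Fin 2) ℂ)) (y : BondL2K ℂ 3 (periodsT3 F K) c₀ W₂) :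
    LinearMap.adjoint (gaugeCorrP F n K h c₀ cB a U₀) y = y - DL2 F n K c₀ U₀ (RS F n K h c₀ cB U₀ (GprimeP F n K h c₀ cB a U₀ (DstarL2 F n K c₀ U₀ y))) := by
  have e : LinearMap.adjoint (gaugeCorrP F n K h c₀ cB a U₀)
      = LinearMap.id - (DL2 F n K c₀ U₀ ∘ₗ RS F n K h c₀ cB U₀ ∘ₗ GprimeP F n K h c₀ cB a U₀) ∘ₗ DstarL2 F n K c₀ U₀ := by
    rw [gaugeCorrP, map_sub, LinearMap.adjoint_id, LinearMap.adjoint_comp, adjoint_GprimeP_RS_DstarL2 F c₀ h cB a ha U₀, adjoint_DL2]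
  rw [e]
  simp only [LinearMap.sub_apply, LinearMap.id_apply, LinearMap.comp_apply]

/-- ★ **THE TWO WORDS OF THE PERTURBATION `Δ′u := Δ_πᴾu − Δ^ηu`**: with `λ₁ := G′ᴾ(R_S(D*u))` and `Pᴾu = u − Dλ₁`,
`Δ_πᴾu − Δ^ηu = −Δ^η(Dλ₁) − D(R_S(G′ᴾ(D*(Δ^η(Pᴾu)))))` (`Δ_πᴾ = Pᴾ†Δ^ηPᴾ`, `Pᴾ† = 1 − DR_SG′ᴾD*`).
[cite: Balaban1985BackgroundPropagators, (3.119)–(3.120) p.419, (3.131) p.422] -/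
theorem DeltaPiP_sub_DeltaEta_apply (ha : 0 ≤ a) (U₀ : GaugeField (F.P K) 0 (Matrix.specialUnitaryGroup (Fin 2) ℂ)) (u : BondL2K ℂ 3 (periodsT3 F K) c₀ W₂) :
    DeltaPiP F n K h c₀ cB a U₀ u - DeltaEta F n K c₀ U₀ u
      = -(DeltaEta F n K c₀ U₀ (DL2 F n K c₀ U₀ (GprimeP F n K h c₀ cB a U₀ (RS F n K h c₀ cB U₀ (DstarL2 F n K c₀ U₀ u)))))
        - DL2 F n K c₀ U₀ (RS F n K h c₀ cB U₀ (GprimeP F n K h c₀ cB a U₀ (DstarL2 F n K c₀ U₀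
            (DeltaEta F n K c₀ U₀ (gaugeCorrP F n K h c₀ cB a U₀ u))))) := by
  rw [DeltaPiP_apply, adjoint_gaugeCorrP_apply ha U₀, sub_right_comm]
  congr 1
  rw [gaugeCorrP_apply U₀ u, map_sub, sub_sub_cancel_left]

/-- `D*Dλ₂ = R_S(G′ᴾj)` for `λ₂ := G′ᴾ(R_S(G′ᴾj))` (FILE B ✓`covLapSite_GprimeP_RS`). [cite: Balaban1985BackgroundPropagators, (3.22)–(3.25) p.394] -/
theorem covLapSite_lambda₂ (ha : 0 ≤ a) (U₀ : GaugeField (F.P K) 0 (Matrix.specialUnitaryGroup (Fin 2) ℂ)) (j : SiteL2K ℂ 3 (periodsT3 F K) c₀ W₂) :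
    DstarL2 F n K c₀ U₀ (DL2 F n K c₀ U₀ (GprimeP F n K h c₀ cB a U₀ (RS F n K h c₀ cB U₀ (GprimeP F n K h c₀ cB a U₀ j))))
      = RS F n K h c₀ cB U₀ (GprimeP F n K h c₀ cB a U₀ j) :=
  covLapSite_GprimeP_RS (h := h) (cB := cB) ha U₀ _

/-- ★★★ **`u = G₀f + G₀(Δ^η(Dλ₁)) + Dλ₂ − G₀(Δ^η(Dλ₂))` FOR `u := G_πf` ON THE CLASS AT BOTH SLOTS** — `u = G₀(Δ_a^ηu)` (✓`GT_laplaceA`), `Δ_a^ηu = Δ_a^πu − Δ′u = f − Δ′u`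
(✓`laplaceA_sub_laplaceA`, ✓`laplaceA_GT`), the two words of `Δ′u`, and (G-iii) ✓`GT_DeltaEtaSlot_DL2_RS_eq` on the pure-gauge word, with `λ₁ := G′ᴾR_SD*u`,
`j := D*Δ^η(Pᴾu)`, `λ₂ := G′ᴾ(R_S(G′ᴾj))`. [cite: Balaban1985BackgroundPropagators, (3.130)–(3.131) pp.421–422, (3.27) p.395] -/
theorem GT_pi_eq_four_terms (ha : 0 ≤ a) {U₀ : GaugeField (F.P K) 0 (Matrix.specialUnitaryGroup (Fin 2) ℂ)}
    (hp₀ : PosOnto F n K h c₀ cB a (DeltaEtaSlot F n K c₀) U₀) (hpπ : PosOnto F n K h c₀ cB a (DeltaPiSlotP F n K h c₀ cB a) U₀)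
    (f : BondL2K ℂ 3 (periodsT3 F K) c₀ W₂) :
    GT F n K h c₀ cB a (DeltaPiSlotP F n K h c₀ cB a) U₀ f
      = GT F n K h c₀ cB a (DeltaEtaSlot F n K c₀) U₀ f
        + GT F n K h c₀ cB a (DeltaEtaSlot F n K c₀) U₀ (DeltaEta F n K c₀ U₀ (DL2 F n K c₀ U₀
            (GprimeP F n K h c₀ cB a U₀ (RS F n K h c₀ cB U₀ (DstarL2 F n K c₀ U₀ (GT F n K h c₀ cB a (DeltaPiSlotP F n K h c₀ cB a) U₀ f))))))
        + (DL2 F n K c₀ U₀ (GprimeP F n K h c₀ cB a U₀ (RS F n K h c₀ cB U₀ (GprimeP F n K h c₀ cB a U₀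
            (DstarL2 F n K c₀ U₀ (DeltaEta F n K c₀ U₀ (gaugeCorrP F n K h c₀ cB a U₀ (GT F n K h c₀ cB a (DeltaPiSlotP F n K h c₀ cB a) U₀ f)))))))
          - GT F n K h c₀ cB a (DeltaEtaSlot F n K c₀) U₀ (DeltaEta F n K c₀ U₀ (DL2 F n K c₀ U₀
            (GprimeP F n K h c₀ cB a U₀ (RS F n K h c₀ cB U₀ (GprimeP F n K h c₀ cB a U₀
            (DstarL2 F n K c₀ U₀ (DeltaEta F n K c₀ U₀ (gaugeCorrP F n K h c₀ cB a U₀ (GT F n K h c₀ cB a (DeltaPiSlotP F n K h c₀ cB a) U₀ f)))))))))) := by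
  -- abbreviate the three heavy vectors by `generalize`-free `have`s on explicit terms
  have h1 := GT_laplaceA hp₀ (GT F n K h c₀ cB a (DeltaPiSlotP F n K h c₀ cB a) U₀ f)
  have h2 : laplaceA F n K h c₀ cB a (DeltaEtaSlot F n K c₀) U₀ (GT F n K h c₀ cB a (DeltaPiSlotP F n K h c₀ cB a) U₀ f)
      = f - (DeltaPiP F n K h c₀ cB a U₀ (GT F n K h c₀ cB a (DeltaPiSlotP F n K h c₀ cB a) U₀ f)
            - DeltaEta F n K c₀ U₀ (GT F n K h c₀ cB a (DeltaPiSlotP F n K h c₀ cB a) U₀ f)) := by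
    have e := congrArg (fun T : BondL2K ℂ 3 (periodsT3 F K) c₀ W₂ →ₗ[ℂ] BondL2K ℂ 3 (periodsT3 F K) c₀ W₂ => T (GT F n K h c₀ cB a (DeltaPiSlotP F n K h c₀ cB a) U₀ f))
      (laplaceA_sub_laplaceA (h := h) (cB := cB) (a := a) (Δ0x := DeltaPiSlotP F n K h c₀ cB a) (Δπx := DeltaEtaSlot F n K c₀) U₀)
    simp only [LinearMap.sub_apply, DeltaPiSlotP_apply, DeltaEtaSlot_apply] at e
    rw [← e, laplaceA_GT hpπ f, sub_sub_cancel]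
  have hΔ := DeltaPiP_sub_DeltaEta_apply (h := h) (cB := cB) ha U₀ (GT F n K h c₀ cB a (DeltaPiSlotP F n K h c₀ cB a) U₀ f)
  have h3 := GT_DeltaEtaSlot_DL2_RS_eq (h := h) (cB := cB) (a := a) hp₀ ha
    (GprimeP F n K h c₀ cB a U₀ (DstarL2 F n K c₀ U₀ (DeltaEta F n K c₀ U₀ (gaugeCorrP F n K h c₀ cB a U₀ (GT F n K h c₀ cB a (DeltaPiSlotP F n K h c₀ cB a) U₀ f)))))
  rw [h2, hΔ, ← neg_add', sub_neg_eq_add, map_add, map_add, h3, ← add_assoc] at h1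
  exact h1.symm

/-! ## §2 The real-arithmetic fixpoint -/

/-- ★ **THE BOOTSTRAP FOR THE PAIR `(X_V, X_D)`**: from `X_V ≤ A_V + p·X_D + q·P`, `X_D ≤ A_D + p′·X_D + q′·P` with `P ≤ X_V + C₂X_D`, all coefficients `≥ 0`, `X_V, X_D ≥ 0` and
`p + p′ + (q + q′)(1 + C₂) ≤ ½`: `X_V + X_D ≤ 2(A_V + A_D)`. [folklore] -/
theorem bootstrap_two {XV XD AV AD p p' q q' C₂ P : ℝ} (hXV : 0 ≤ XV) (hXD : 0 ≤ XD) (hp : 0 ≤ p) (hp' : 0 ≤ p') (hq : 0 ≤ q) (hq' : 0 ≤ q') (hC₂ : 0 ≤ C₂)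
    (hP : P ≤ XV + C₂ * XD) (h1 : XV ≤ AV + p * XD + q * P) (h2 : XD ≤ AD + p' * XD + q' * P) (hκ : p + p' + (q + q') * (1 + C₂) ≤ 1 / 2) :
    XV + XD ≤ 2 * (AV + AD) := by
  have hPX : P ≤ (1 + C₂) * (XV + XD) := by nlinarith
  have hXD' : XD ≤ XV + XD := by linarith
  have hsum : XV + XD ≤ (AV + AD) + (p + p' + (q + q') * (1 + C₂)) * (XV + XD) := by nlinarith
  nlinarith

/-- ★ **POINTWISE ASSEMBLY OF THE FOUR-TERM IDENTITY**: if `u = G₀f + G₀A₁ + (Dℓ₂ − G₀A₂)` and each of the four pieces (and each of their divergences) is bounded at a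
point, then so are `u` and `D*u` there — `map_add`∕`norm_add_le` bookkeeping kept on ABSTRACT vectors so that the member instance below elaborates cheaply. [folklore] -/
theorem pointwise_of_four_terms (G₀ : BondL2K ℂ 3 (periodsT3 F K) c₀ W₂ →ₗ[ℂ] BondL2K ℂ 3 (periodsT3 F K) c₀ W₂) (U₀ : GaugeField (F.P K) 0 (Matrix.specialUnitaryGroup (Fin 2) ℂ))
    (u f A₁ A₂ Dl₂ : BondL2K ℂ 3 (periodsT3 F K) c₀ W₂) (h4 : u = G₀ f + G₀ A₁ + (Dl₂ - G₀ A₂)) (b₀ : PBond (F.P K) 0) (x₀ : Site (F.P K) 0)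
    {a₀ a₁ a₂ a₃ d₀ d₁ d₂ d₃ : ℝ}
    (hV₀ : ‖(toL2 F K c₀).symm (G₀ f) b₀‖ ≤ a₀) (hV₁ : ‖(toL2 F K c₀).symm (G₀ A₁) b₀‖ ≤ a₁) (hDl₂ : ‖(toL2 F K c₀).symm Dl₂ b₀‖ ≤ a₂)
    (hV₂ : ‖(toL2 F K c₀).symm (G₀ A₂) b₀‖ ≤ a₃)
    (hD₀ : ‖(toL2S F K c₀).symm (DstarL2 F n K c₀ U₀ (G₀ f)) x₀‖ ≤ d₀) (hD₁ : ‖(toL2S F K c₀).symm (DstarL2 F n K c₀ U₀ (G₀ A₁)) x₀‖ ≤ d₁)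
    (hDDl₂ : ‖(toL2S F K c₀).symm (DstarL2 F n K c₀ U₀ Dl₂) x₀‖ ≤ d₂) (hD₂ : ‖(toL2S F K c₀).symm (DstarL2 F n K c₀ U₀ (G₀ A₂)) x₀‖ ≤ d₃) :
    ‖(toL2 F K c₀).symm u b₀‖ ≤ a₀ + a₁ + (a₂ + a₃) ∧ ‖(toL2S F K c₀).symm (DstarL2 F n K c₀ U₀ u) x₀‖ ≤ d₀ + d₁ + (d₂ + d₃) := by
  subst h4
  constructor
  · simp only [map_add, map_sub, Pi.add_apply, Pi.sub_apply]
    exact (norm_add_le _ _).trans (add_le_add ((norm_add_le _ _).trans (add_le_add hV₀ hV₁)) ((norm_sub_le _ _).trans (add_le_add hDl₂ hV₂)))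
  · simp only [map_add, map_sub, Pi.add_apply, Pi.sub_apply]
    exact (norm_add_le _ _).trans (add_le_add ((norm_add_le _ _).trans (add_le_add hD₀ hD₁)) ((norm_sub_le _ _).trans (add_le_add hDDl₂ hD₂)))

/-! ## §3 The VALUE and DIVERGENCE rows of `G_π` from the `G₀` rows and the scalar-storey sup letters -/

/-- ★★★★ **THE `(sup, sup∘D*)` ROWS OF `G_π` FROM THOSE OF `G₀`, K-FREE, HÖLDER-FREE** (LOCATE-N6 §2(ii) road of record).  At `U₀ ∈ RegPr α`, on the class at the slots `Δ^η` and
`Δ_πᴾ`, `0 ≤ a`, given: (V) `|G₀X| ≤ BV·sup|X|` (N4 ✓p768228's shape), (div) `|D*G₀X| ≤ BD·sup|X|` (N5's divergence reading), (c1) `|G′ᴾR_Sv| ≤ C₁sup|v|`, (c2) `|DG′ᴾR_Sv| ≤ C₂sup|v|`,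
(c3) `|R_SG′ᴾv| ≤ C₃sup|v|` (the scalar storey's `hGsup`∕`hT1` readings), and the window `κ := 4αC₁(BV+BD) + 12αC₃(1+C₂)(1+C₂+4αC₁(BV+BD)) ≤ ½` — THEN for every source `X` with
`‖X b‖ ≤ s`: `‖(toL2⁻¹(G_π(toL2 X)))(b)‖ ≤ 2(BV+BD)·s` and `‖(toL2S⁻¹(D*G_π(toL2 X)))(x)‖ ≤ 2(BV+BD)·s`.  PROOF: §1's four-term identity, FILE A's (C-val)∕(C-div), the letters, §2.
[cite: Balaban1985BackgroundPropagators, (3.130)–(3.131) pp.421–422, Thm 3.12 (3.42) pp.422–423, (3.122) p.420] -/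
theorem valueDiv_rows_GTpi_of_letters {α : ℝ} (U₀ : GaugeField (F.P K) 0 (Matrix.specialUnitaryGroup (Fin 2) ℂ)) (hreg : RegPr F n K α U₀) (ha : 0 ≤ a)
    (hp₀ : PosOnto F n K h c₀ cB a (DeltaEtaSlot F n K c₀) U₀) (hpπ : PosOnto F n K h c₀ cB a (DeltaPiSlotP F n K h c₀ cB a) U₀)
    {BV BD C₁ C₂ C₃ : ℝ} (hBV : 0 ≤ BV) (hBD : 0 ≤ BD) (hC₁ : 0 ≤ C₁) (hC₂ : 0 ≤ C₂) (hC₃ : 0 ≤ C₃)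
    (hV : ∀ (X : PBond (F.P K) 0 → Matrix (Fin 2) (Fin 2) ℂ) (s : ℝ), (∀ b, ‖X b‖ ≤ s) →
      ∀ b, ‖(toL2 F K c₀).symm (GT F n K h c₀ cB a (DeltaEtaSlot F n K c₀) U₀ (toL2 F K c₀ X)) b‖ ≤ BV * s)
    (hDiv : ∀ (X : PBond (F.P K) 0 → Matrix (Fin 2) (Fin 2) ℂ) (s : ℝ), (∀ b, ‖X b‖ ≤ s) →
      ∀ x, ‖(toL2S F K c₀).symm (DstarL2 F n K c₀ U₀ (GT F n K h c₀ cB a (DeltaEtaSlot F n K c₀) U₀ (toL2 F K c₀ X))) x‖ ≤ BD * s)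
    (hc1 : ∀ (v : Site (F.P K) 0 → Matrix (Fin 2) (Fin 2) ℂ) (m : ℝ), (∀ x, ‖v x‖ ≤ m) →
      ∀ x, ‖(toL2S F K c₀).symm (GprimeP F n K h c₀ cB a U₀ (RS F n K h c₀ cB U₀ (toL2S F K c₀ v))) x‖ ≤ C₁ * m)
    (hc2 : ∀ (v : Site (F.P K) 0 → Matrix (Fin 2) (Fin 2) ℂ) (m : ℝ), (∀ x, ‖v x‖ ≤ m) →
      ∀ b, ‖(toL2 F K c₀).symm (DL2 F n K c₀ U₀ (GprimeP F n K h c₀ cB a U₀ (RS F n K h c₀ cB U₀ (toL2S F K c₀ v)))) b‖ ≤ C₂ * m)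
    (hc3 : ∀ (v : Site (F.P K) 0 → Matrix (Fin 2) (Fin 2) ℂ) (m : ℝ), (∀ x, ‖v x‖ ≤ m) →
      ∀ x, ‖(toL2S F K c₀).symm (RS F n K h c₀ cB U₀ (GprimeP F n K h c₀ cB a U₀ (toL2S F K c₀ v))) x‖ ≤ C₃ * m)
    (hwin : 4 * α * C₁ * (BV + BD) + 12 * α * C₃ * (1 + C₂) * (1 + C₂ + 4 * α * C₁ * (BV + BD)) ≤ 1 / 2)
    (X : PBond (F.P K) 0 → Matrix (Fin 2) (Fin 2) ℂ) {s : ℝ} (hX : ∀ b, ‖X b‖ ≤ s) :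
    (∀ b, ‖(toL2 F K c₀).symm (GT F n K h c₀ cB a (DeltaPiSlotP F n K h c₀ cB a) U₀ (toL2 F K c₀ X)) b‖ ≤ 2 * (BV + BD) * s) ∧
    (∀ x, ‖(toL2S F K c₀).symm (DstarL2 F n K c₀ U₀ (GT F n K h c₀ cB a (DeltaPiSlotP F n K h c₀ cB a) U₀ (toL2 F K c₀ X))) x‖ ≤ 2 * (BV + BD) * s) := by
  classical
  have hη : 0 < eta F n K := eta_pos F n K
  have hs : 0 ≤ s := (norm_nonneg _).trans (hX ⟨Classical.arbitrary _, 0⟩)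
  -- `0 ≤ α` from the current bound
  have hα : 0 ≤ α := by
    have hJ := Prop7DeltaPiDefectPairing.norm_J_one_le_of_regPr U₀ hreg 0 (Classical.arbitrary _)
    have h0 : 0 * eta F n K ^ 3 ≤ α * eta F n K ^ 3 := by rw [zero_mul]; exact (norm_nonneg _).trans hJ
    exact le_of_mul_le_mul_right h0 (pow_pos hη 3)
  -- the four-term identity (before the abbreviations, which then fold inside it)
  have h4 := GT_pi_eq_four_terms (h := h) (cB := cB) ha hp₀ hpπ (toL2 F K c₀ X)
  -- the objects
  set f := toL2 F K c₀ X with hf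
  set u := GT F n K h c₀ cB a (DeltaPiSlotP F n K h c₀ cB a) U₀ f with hu
  set lam₁ := GprimeP F n K h c₀ cB a U₀ (RS F n K h c₀ cB U₀ (DstarL2 F n K c₀ U₀ u)) with hlam₁
  set j := DstarL2 F n K c₀ U₀ (DeltaEta F n K c₀ U₀ (gaugeCorrP F n K h c₀ cB a U₀ u)) with hj
  set lam₂ := GprimeP F n K h c₀ cB a U₀ (RS F n K h c₀ cB U₀ (GprimeP F n K h c₀ cB a U₀ j)) with hlam₂
  set G₀ := GT F n K h c₀ cB a (DeltaEtaSlot F n K c₀) U₀ with hG₀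
  -- the divergence reader and the maximisers
  set V : Site (F.P K) 0 → Matrix (Fin 2) (Fin 2) ℂ := (toL2S F K c₀).symm (DstarL2 F n K c₀ U₀ u) with hVd
  haveI : Nonempty (PBond (F.P K) 0) := ⟨⟨Classical.arbitrary _, 0⟩⟩
  obtain ⟨b₀, -, hb₀⟩ := Finset.exists_max_image Finset.univ (fun b => ‖(toL2 F K c₀).symm u b‖) Finset.univ_nonempty
  obtain ⟨x₀, -, hx₀⟩ := Finset.exists_max_image Finset.univ (fun x => ‖V x‖) Finset.univ_nonempty
  have hUb : ∀ b, ‖(toL2 F K c₀).symm u b‖ ≤ ‖(toL2 F K c₀).symm u b₀‖ := fun b => hb₀ b (Finset.mem_univ b)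
  have hVx : ∀ x, ‖V x‖ ≤ ‖V x₀‖ := fun x => hx₀ x (Finset.mem_univ x)
  have hXV0 : 0 ≤ ‖(toL2 F K c₀).symm u b₀‖ := norm_nonneg _
  have hXD0 : 0 ≤ ‖V x₀‖ := norm_nonneg _
  -- (c1)(c2) on `λ₁ = G′ᴾR_S(toL2S V)`
  have hVeq : toL2S F K c₀ V = DstarL2 F n K c₀ U₀ u := LinearEquiv.apply_symm_apply _ _
  have hlam₁V : lam₁ = GprimeP F n K h c₀ cB a U₀ (RS F n K h c₀ cB U₀ (toL2S F K c₀ V)) := by rw [hVeq]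
  have hl₁ : ∀ x, ‖(toL2S F K c₀).symm lam₁ x‖ ≤ C₁ * ‖V x₀‖ := fun x => by rw [hlam₁V]; exact hc1 V ‖V x₀‖ hVx x
  have hDl₁ : ∀ b, ‖(toL2 F K c₀).symm (DL2 F n K c₀ U₀ lam₁) b‖ ≤ C₂ * ‖V x₀‖ := fun b => by rw [hlam₁V]; exact hc2 V ‖V x₀‖ hVx b
  -- `Pᴾu = u − Dλ₁` pointwise
  set Pu : PBond (F.P K) 0 → Matrix (Fin 2) (Fin 2) ℂ := (toL2 F K c₀).symm (gaugeCorrP F n K h c₀ cB a U₀ u) with hPu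
  have hPu_le : ∀ b, ‖Pu b‖ ≤ ‖(toL2 F K c₀).symm u b₀‖ + C₂ * ‖V x₀‖ := by
    intro b
    have e : Pu b = (toL2 F K c₀).symm u b - (toL2 F K c₀).symm (DL2 F n K c₀ U₀ lam₁) b := by
      rw [hPu, gaugeCorrP_apply, map_sub, Pi.sub_apply]
    rw [e]
    exact (norm_sub_le _ _).trans (add_le_add (hUb b) (hDl₁ b))
  -- (C-div) on `j = D*Δ^η(Pᴾu)`
  have hPueq : toL2 F K c₀ Pu = gaugeCorrP F n K h c₀ cB a U₀ u := LinearEquiv.apply_symm_apply _ _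
  have hjle : ∀ x, ‖(toL2S F K c₀).symm j x‖ ≤ 12 * α * (‖(toL2 F K c₀).symm u b₀‖ + C₂ * ‖V x₀‖) := by
    intro x
    rw [hj, ← hPueq]
    exact norm_symm_DstarL2_DeltaEta_toL2_apply_le U₀ hreg Pu hPu_le x
  -- (c3) on `g₂′ = R_S(G′ᴾ j)`, then (c1)(c2) on `λ₂ = G′ᴾ(R_S g₂′)`
  set Jv : Site (F.P K) 0 → Matrix (Fin 2) (Fin 2) ℂ := (toL2S F K c₀).symm j with hJv
  have hJveq : toL2S F K c₀ Jv = j := LinearEquiv.apply_symm_apply _ _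
  set g₂ := RS F n K h c₀ cB U₀ (GprimeP F n K h c₀ cB a U₀ j) with hg₂
  have hg₂le : ∀ x, ‖(toL2S F K c₀).symm g₂ x‖ ≤ C₃ * (12 * α * (‖(toL2 F K c₀).symm u b₀‖ + C₂ * ‖V x₀‖)) := fun x => by
    rw [hg₂, ← hJveq]; exact hc3 Jv _ hjle x
  set Gv : Site (F.P K) 0 → Matrix (Fin 2) (Fin 2) ℂ := (toL2S F K c₀).symm g₂ with hGv
  have hGveq : toL2S F K c₀ Gv = g₂ := LinearEquiv.apply_symm_apply _ _
  have hlam₂G : lam₂ = GprimeP F n K h c₀ cB a U₀ (RS F n K h c₀ cB U₀ (toL2S F K c₀ Gv)) := by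
    rw [hGveq, hg₂, RS_RS]
  have hl₂ : ∀ x, ‖(toL2S F K c₀).symm lam₂ x‖ ≤ C₁ * (C₃ * (12 * α * (‖(toL2 F K c₀).symm u b₀‖ + C₂ * ‖V x₀‖))) := fun x => by
    rw [hlam₂G]; exact hc1 Gv _ hg₂le x
  have hDl₂ : ∀ b, ‖(toL2 F K c₀).symm (DL2 F n K c₀ U₀ lam₂) b‖ ≤ C₂ * (C₃ * (12 * α * (‖(toL2 F K c₀).symm u b₀‖ + C₂ * ‖V x₀‖))) := fun b => by
    rw [hlam₂G]; exact hc2 Gv _ hg₂le b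
  -- (C-val) on the two defect sources `Δ^η(Dλᵢ)`
  have hsrc : ∀ (lam : SiteL2K ℂ 3 (periodsT3 F K) c₀ W₂) (m : ℝ), (∀ x, ‖(toL2S F K c₀).symm lam x‖ ≤ m) →
      ∀ b, ‖(toL2 F K c₀).symm (DeltaEta F n K c₀ U₀ (DL2 F n K c₀ U₀ lam)) b‖ ≤ 4 * α * m := by
    intro lam m hm b
    have e : lam = toL2S F K c₀ ((toL2S F K c₀).symm lam) := (LinearEquiv.apply_symm_apply _ _).symm
    rw [e]
    exact norm_symm_DeltaEta_DL2_toL2S_apply_le_of_sup U₀ hreg _ hm b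
  have hS₁ := hsrc lam₁ (C₁ * ‖V x₀‖) hl₁
  have hS₂ := hsrc lam₂ (C₁ * (C₃ * (12 * α * (‖(toL2 F K c₀).symm u b₀‖ + C₂ * ‖V x₀‖)))) hl₂
  -- the `G₀` rows on the three bounded sources `X`, `Δ^η(Dλ₁)`, `Δ^η(Dλ₂)`
  have hread : ∀ y : BondL2K ℂ 3 (periodsT3 F K) c₀ W₂, y = toL2 F K c₀ ((toL2 F K c₀).symm y) := fun y => (LinearEquiv.apply_symm_apply _ _).symm
  have hV₀ := hV X s hX
  have hV₁ : ∀ b, ‖(toL2 F K c₀).symm (G₀ (DeltaEta F n K c₀ U₀ (DL2 F n K c₀ U₀ lam₁))) b‖ ≤ BV * (4 * α * (C₁ * ‖V x₀‖)) := fun b => by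
    rw [hread (DeltaEta F n K c₀ U₀ (DL2 F n K c₀ U₀ lam₁))]; exact hV _ _ hS₁ b
  have hV₂ : ∀ b, ‖(toL2 F K c₀).symm (G₀ (DeltaEta F n K c₀ U₀ (DL2 F n K c₀ U₀ lam₂))) b‖ ≤ BV * (4 * α * (C₁ * (C₃ * (12 * α * (‖(toL2 F K c₀).symm u b₀‖ + C₂ * ‖V x₀‖))))) := fun b => by
    rw [hread (DeltaEta F n K c₀ U₀ (DL2 F n K c₀ U₀ lam₂))]; exact hV _ _ hS₂ b
  have hD₀ := hDiv X s hX
  have hD₁ : ∀ x, ‖(toL2S F K c₀).symm (DstarL2 F n K c₀ U₀ (G₀ (DeltaEta F n K c₀ U₀ (DL2 F n K c₀ U₀ lam₁)))) x‖ ≤ BD * (4 * α * (C₁ * ‖V x₀‖)) := fun x => by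
    rw [hread (DeltaEta F n K c₀ U₀ (DL2 F n K c₀ U₀ lam₁))]; exact hDiv _ _ hS₁ x
  have hD₂ : ∀ x, ‖(toL2S F K c₀).symm (DstarL2 F n K c₀ U₀ (G₀ (DeltaEta F n K c₀ U₀ (DL2 F n K c₀ U₀ lam₂)))) x‖
      ≤ BD * (4 * α * (C₁ * (C₃ * (12 * α * (‖(toL2 F K c₀).symm u b₀‖ + C₂ * ‖V x₀‖))))) := fun x => by
    rw [hread (DeltaEta F n K c₀ U₀ (DL2 F n K c₀ U₀ lam₂))]; exact hDiv _ _ hS₂ x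
  -- `D*Dλ₂ = g₂`
  have hDDl₂ : ∀ x, ‖(toL2S F K c₀).symm (DstarL2 F n K c₀ U₀ (DL2 F n K c₀ U₀ lam₂)) x‖ ≤ C₃ * (12 * α * (‖(toL2 F K c₀).symm u b₀‖ + C₂ * ‖V x₀‖)) := fun x => by
    rw [hlam₂, covLapSite_lambda₂ (h := h) (cB := cB) ha U₀ j]; exact hg₂le x
  -- VALUE and DIVERGENCE at the maximisers, by the abstract assembly
  have hasm := pointwise_of_four_terms (n := n) G₀ U₀ u f _ _ _ h4 b₀ x₀ (hV₀ b₀) (hV₁ b₀) (hDl₂ b₀) (hV₂ b₀) (hD₀ x₀) (hD₁ x₀) (hDDl₂ x₀) (hD₂ x₀)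
  have hXV : ‖(toL2 F K c₀).symm u b₀‖ ≤ BV * s + BV * (4 * α * (C₁ * ‖V x₀‖)) + (C₂ * (C₃ * (12 * α * (‖(toL2 F K c₀).symm u b₀‖ + C₂ * ‖V x₀‖))) + BV * (4 * α * (C₁ * (C₃ * (12 * α * (‖(toL2 F K c₀).symm u b₀‖ + C₂ * ‖V x₀‖)))))) :=
    hasm.1
  have hXD : ‖V x₀‖ ≤ BD * s + BD * (4 * α * (C₁ * ‖V x₀‖)) + (C₃ * (12 * α * (‖(toL2 F K c₀).symm u b₀‖ + C₂ * ‖V x₀‖)) + BD * (4 * α * (C₁ * (C₃ * (12 * α * (‖(toL2 F K c₀).symm u b₀‖ + C₂ * ‖V x₀‖)))))) :=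
    hasm.2
  -- the fixpoint
  have hfix : ‖(toL2 F K c₀).symm u b₀‖ + ‖V x₀‖ ≤ 2 * (BV * s + BD * s) := by
    refine bootstrap_two (XV := ‖(toL2 F K c₀).symm u b₀‖) (XD := ‖V x₀‖) (AV := BV * s) (AD := BD * s) (p := BV * (4 * α * C₁)) (p' := BD * (4 * α * C₁))
      (q := 12 * α * C₃ * (C₂ + BV * (4 * α * C₁))) (q' := 12 * α * C₃ * (1 + BD * (4 * α * C₁))) (C₂ := C₂) (P := ‖(toL2 F K c₀).symm u b₀‖ + C₂ * ‖V x₀‖)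
      hXV0 hXD0 (by positivity) (by positivity) (by positivity) (by positivity) hC₂ le_rfl ?_ ?_ ?_
    · have : BV * s + BV * (4 * α * (C₁ * ‖V x₀‖)) + (C₂ * (C₃ * (12 * α * (‖(toL2 F K c₀).symm u b₀‖ + C₂ * ‖V x₀‖))) + BV * (4 * α * (C₁ * (C₃ * (12 * α * (‖(toL2 F K c₀).symm u b₀‖ + C₂ * ‖V x₀‖))))))
          = BV * s + BV * (4 * α * C₁) * ‖V x₀‖ + 12 * α * C₃ * (C₂ + BV * (4 * α * C₁)) * (‖(toL2 F K c₀).symm u b₀‖ + C₂ * ‖V x₀‖) := by ring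
      linarith [hXV, this]
    · have : BD * s + BD * (4 * α * (C₁ * ‖V x₀‖)) + (C₃ * (12 * α * (‖(toL2 F K c₀).symm u b₀‖ + C₂ * ‖V x₀‖)) + BD * (4 * α * (C₁ * (C₃ * (12 * α * (‖(toL2 F K c₀).symm u b₀‖ + C₂ * ‖V x₀‖))))))
          = BD * s + BD * (4 * α * C₁) * ‖V x₀‖ + 12 * α * C₃ * (1 + BD * (4 * α * C₁)) * (‖(toL2 F K c₀).symm u b₀‖ + C₂ * ‖V x₀‖) := by ring
      linarith [hXD, this]
    · have : BV * (4 * α * C₁) + BD * (4 * α * C₁) + (12 * α * C₃ * (C₂ + BV * (4 * α * C₁)) + 12 * α * C₃ * (1 + BD * (4 * α * C₁))) * (1 + C₂)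
          = 4 * α * C₁ * (BV + BD) + 12 * α * C₃ * (1 + C₂) * (1 + C₂ + 4 * α * C₁ * (BV + BD)) := by ring
      linarith [hwin, this]
  have hfix' : ‖(toL2 F K c₀).symm u b₀‖ + ‖V x₀‖ ≤ 2 * (BV + BD) * s := by linarith [hfix]
  refine ⟨fun b => ?_, fun x => ?_⟩
  · calc ‖(toL2 F K c₀).symm (GT F n K h c₀ cB a (DeltaPiSlotP F n K h c₀ cB a) U₀ (toL2 F K c₀ X)) b‖ = ‖(toL2 F K c₀).symm u b‖ := rfl
      _ ≤ ‖(toL2 F K c₀).symm u b₀‖ := hUb b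
      _ ≤ 2 * (BV + BD) * s := by linarith
  · calc ‖(toL2S F K c₀).symm (DstarL2 F n K c₀ U₀ (GT F n K h c₀ cB a (DeltaPiSlotP F n K h c₀ cB a) U₀ (toL2 F K c₀ X))) x‖ = ‖V x‖ := rfl
      _ ≤ ‖V x₀‖ := hVx x
      _ ≤ 2 * (BV + BD) * s := by linarith

end Summit.QuantumFields.YangMills.Theorems.Prop7GreenPiSupRowsOfLetters

end
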